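import Summits.AtomisticToContinuum.BoseEinsteinCondensation.Theorems.BECStronglyRayleighLatticeCoherenceAssemblyLowerNorm
import Literature.MathematicalPhysics.QuantumLattice.XYZGroundStateOrderProofs
import HarnessLib

/-!
# One free hard-core boson on the torus (helper for `LatticeCoherenceAssembly`,
# item stmt-AtomisticToContinuum-9680, route BECStronglyRayleigh)

The `N = 1` case of the coherence bound. For the `Δ = 0` XXZ Hamiltonian on a graph all of whose
vertices have the same degree `D`, the uniform one-particle state `u = Σ_w δ_{1_{{w}}}` is an
eigenvector (`xxzZero_mulVec_oneParticle`: one-particle matrix elements are `(J/2)·[w ∼ z]`,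
`xxzZero_apply_ind_singleton`). On the torus `(ℤ/Lℤ)^d`, `L ≥ 3` (`2d`-regular), `u` has positive
overlap with the nonnegative Perron vector `ψ` of the one-particle sector, hence the same eigenvalue,
hence `u = cψ` by sector uniqueness; and `‖Ŝ⁻_tot u‖² = (L^d)²`, `‖u‖² = L^d`, so
`‖Ŝ⁻_tot ψ‖² = L^d ‖ψ‖²` (`oneParticle_norm_lower`).
-/

noncomputable section

namespace Summit.AtomisticToContinuum.BoseEinsteinCondensation.Theorems.LatticeCoherence

open scoped BigOperators Matrix ComplexOrder
open Literature.MathematicalPhysics.QuantumLattice Literature.Probability.LatticeModels Matrix Finset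
  Complex
open Summit.AtomisticToContinuum.BoseEinsteinCondensation.Theorems.InsertionFieldDelocalisation.Negative

section Graph

variable {Λ : Type*} [Fintype Λ] [DecidableEq Λ] (G : SimpleGraph Λ) [DecidableRel G.Adj] (J : ℝ)

/-- The spin-`½` raising matrix: `⟨k| S⁺ |l⟩ = [k = ↑, l = ↓]`. [folklore] -/
theorem spinRaise_one_apply (k l : Fin 2) :
    spinRaise 1 k l = if k = 0 ∧ l = 1 then 1 else 0 := by
  rw [spinRaise_apply]
  fin_cases k <;> fin_cases l <;> simp

omit [Fintype Λ] in
/-- Distinct sites have distinct one-particle indicators `1_{{w}} ≠ 1_{{z}}`. [folklore] -/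
theorem ind_singleton_ne {w z : Λ} (hwz : w ≠ z) :
    (fun u => if u ∈ ({w} : Finset Λ) then (0 : Fin 2) else 1) ≠
      fun u => if u ∈ ({z} : Finset Λ) then (0 : Fin 2) else 1 := by
  rw [Ne, ind_eq_ind_iff, Finset.singleton_inj]
  exact hwz

/-- **One-particle matrix elements of a bond**: for `x ≠ y` and `w ≠ z`,
`⟨1_{{w}}| 𝐒_x·𝐒_y |1_{{z}}⟩ = ½ [{x,y} = {w,z}]` (spin `½`: the hop amplitude is `1`). [folklore] -/
theorem spinDot_apply_ind_singleton {x y w z : Λ} (hxy : x ≠ y) (hwz : w ≠ z) :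
    spinDot 1 x y (fun u => if u ∈ ({w} : Finset Λ) then (0 : Fin 2) else 1)
        (fun u => if u ∈ ({z} : Finset Λ) then (0 : Fin 2) else 1) =
      if s(x, y) = s(w, z) then 1 / 2 else 0 := by
  rw [LiebMattis.spinDot_apply_of_ne 1 hxy (ind_singleton_ne hwz)]
  simp only [Finset.mem_singleton]
  by_cases he : s(x, y) = s(w, z)
  · rw [if_pos he]
    rcases Sym2.eq_iff.mp he with ⟨rfl, rfl⟩ | ⟨rfl, rfl⟩
    · rw [if_pos (fun u hux huy => by simp [hux, huy])]
      simp [spinRaise_one_apply, spinLower_one_apply, hxy, hxy.symm]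
    · rw [if_pos (fun u hux huy => by simp [hux, huy])]
      simp [spinRaise_one_apply, spinLower_one_apply, hxy, hxy.symm]
  · rw [if_neg he, if_neg]
    intro hcond
    apply he
    have hw : w = x ∨ w = y := by
      by_contra h
      push Not at h
      have := hcond w h.1 h.2
      simp [hwz] at this
    have hz : z = x ∨ z = y := by
      by_contra h
      push Not at h
      have := hcond z h.1 h.2
      simp [hwz.symm] at this
    rcases hw with rfl | rfl <;> rcases hz with rfl | rfl
    · exact absurd rfl hwz
    · rfl
    · exact Sym2.eq_swap
    · exact absurd rfl hwz

/-- **One-particle matrix elements of the `Δ = 0` XXZ Hamiltonian**: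
`⟨1_{{w}}| H |1_{{z}}⟩ = (J/2)·[w ∼ z]` (hopping `J/2` along every edge, no diagonal). [folklore] -/
theorem xxzZero_apply_ind_singleton (w z : Λ) :
    xxzHamiltonian 1 G J 0 (fun u => if u ∈ ({w} : Finset Λ) then (0 : Fin 2) else 1)
        (fun u => if u ∈ ({z} : Finset Λ) then (0 : Fin 2) else 1) =
      if G.Adj w z then (J : ℂ) / 2 else 0 := by
  by_cases hwz : w = z
  · subst hwz
    rw [xxzZero_apply, if_pos rfl, if_neg (G.loopless.irrefl w)]
  rw [xxzZero_apply, if_neg (ind_singleton_ne hwz), LiebMattis.heisenbergHamiltonian_apply]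
  have hterm : ∀ e ∈ G.edgeFinset,
      spinDotSym 1 e (fun u => if u ∈ ({w} : Finset Λ) then (0 : Fin 2) else 1)
          (fun u => if u ∈ ({z} : Finset Λ) then (0 : Fin 2) else 1) =
        if e = s(w, z) then 1 / 2 else 0 := by
    intro e
    induction e using Sym2.ind with
    | h x y =>
      intro he
      rw [SimpleGraph.mem_edgeFinset, SimpleGraph.mem_edgeSet] at he
      rw [spinDotSym_mk]
      exact spinDot_apply_ind_singleton he.ne hwz
  rw [Finset.sum_congr rfl hterm, Finset.sum_ite_eq']
  simp only [SimpleGraph.mem_edgeFinset, SimpleGraph.mem_edgeSet]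
  split_ifs
  · ring
  · rw [mul_zero]

/-- The occupied set of `1_S` is `S`. [folklore] -/
theorem filter_ind_eq (S : Finset Λ) :
    (Finset.univ.filter fun x => (fun u => if u ∈ S then (0 : Fin 2) else 1) x = 0) = S := by
  ext x
  by_cases hx : x ∈ S <;> simp [hx]

/-- The `Δ = 0` XXZ Hamiltonian has no matrix elements between occupation indicators of different
particle number. [folklore] -/
theorem xxzZero_apply_ind_eq_zero_of_card_ne {S T : Finset Λ} (h : S.card ≠ T.card) :
    xxzHamiltonian 1 G J 0 (fun u => if u ∈ S then (0 : Fin 2) else 1)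
      (fun u => if u ∈ T then (0 : Fin 2) else 1) = 0 := by
  refine xxzZero_apply_eq_zero_of_weight_ne G J ?_
  rw [weight_ind, weight_ind, Finset.card_compl, Finset.card_compl]
  have hS := Finset.card_le_univ S
  have hT := Finset.card_le_univ T
  omega

/-- **The uniform one-particle state is an eigenvector on a regular graph**: if every vertex has
`Σ_z [w ∼ z] = D`, the vector `u = Σ_w δ_{1_{{w}}}` satisfies `H u = (J D/2) u` for the `Δ = 0` XXZ
Hamiltonian (one free hard-core boson in its zero-momentum state). [folklore] -/
theorem xxzZero_mulVec_oneParticle (D : ℂ) (hreg : ∀ w, (∑ z, if G.Adj w z then (1 : ℂ) else 0) = D)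
    (u : TensorIndex Λ 2 → ℂ)
    (hu : ∀ σ, u σ = if (Finset.univ.filter fun x => σ x = 0).card = 1 then 1 else 0) :
    xxzHamiltonian 1 G J 0 *ᵥ u = ((J : ℂ) / 2 * D) • u := by
  have huT : ∀ T : Finset Λ, u (fun x => if x ∈ T then (0 : Fin 2) else 1) =
      if T.card = 1 then 1 else 0 := by
    intro T
    rw [hu, filter_ind_eq]
  have hpc : (Finset.univ.filter fun T : Finset Λ => T.card = 1) = Finset.univ.powersetCard 1 := by
    ext T
    simp [Finset.mem_powersetCard]
  have key : ∀ S : Finset Λ,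
      (xxzHamiltonian 1 G J 0 *ᵥ u) (fun x => if x ∈ S then (0 : Fin 2) else 1) =
        (J : ℂ) / 2 * D * u (fun x => if x ∈ S then (0 : Fin 2) else 1) := by
    intro S
    rw [mulVec, dotProduct, sum_config_eq_sum_finset]
    simp_rw [huT, mul_ite, mul_one, mul_zero]
    rw [← Finset.sum_filter, hpc, Finset.powersetCard_one, Finset.sum_map]
    by_cases hS1 : S.card = 1
    · obtain ⟨w, rfl⟩ := Finset.card_eq_one.mp hS1
      rw [if_pos hS1]
      simp only [Function.Embedding.coeFn_mk]
      simp_rw [xxzZero_apply_ind_singleton G J w]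
      rw [← hreg w, Finset.mul_sum]
      refine Finset.sum_congr rfl fun z _ => ?_
      split_ifs <;> simp
    · rw [if_neg hS1]
      refine Finset.sum_eq_zero fun z _ => ?_
      simp only [Function.Embedding.coeFn_mk]
      refine xxzZero_apply_ind_eq_zero_of_card_ne G J ?_
      rw [Finset.card_singleton]
      exact hS1
  funext σ
  have h := key (Finset.univ.filter fun x => σ x = 0)
  rw [ind_filter_eq] at h
  rw [Pi.smul_apply, smul_eq_mul, h]

/-- **Equal eigenvalues from a nonzero overlap**: eigenvectors of a Hermitian matrix with
`⟨u, ψ⟩ ≠ 0` have the same eigenvalue (`u`'s eigenvalue real). [folklore] -/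
theorem eigenvalue_eq_of_dotProduct_ne_zero {ι : Type*} [Fintype ι] {A : Matrix ι ι ℂ}
    (hA : A.IsHermitian) {u ψ : ι → ℂ} {a : ℝ} {b : ℂ} (hu : A *ᵥ u = (a : ℂ) • u)
    (hψ : A *ᵥ ψ = b • ψ) (h : star u ⬝ᵥ ψ ≠ 0) : (a : ℂ) = b := by
  have h1 : star u ⬝ᵥ (A *ᵥ ψ) = b * (star u ⬝ᵥ ψ) := by
    rw [hψ, dotProduct_smul, smul_eq_mul]
  have h2 : star u ⬝ᵥ (A *ᵥ ψ) = (a : ℂ) * (star u ⬝ᵥ ψ) := by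
    have h3 : star u ⬝ᵥ (A *ᵥ ψ) = star (A *ᵥ u) ⬝ᵥ ψ := by
      rw [dotProduct_mulVec, star_mulVec, hA.eq]
    rw [h3, hu, star_smul, Complex.star_def, Complex.conj_ofReal, smul_dotProduct, smul_eq_mul]
  exact mul_right_cancel₀ h (h2.symm.trans h1)

omit [DecidableEq Λ] in
/-- `⟨c v, c v⟩ = |c|² ⟨v, v⟩`. [folklore] -/
theorem star_smul_dotProduct_smul (c : ℂ) (v : Λ → ℂ) :
    star (c • v) ⬝ᵥ (c • v) = ((‖c‖ ^ 2 : ℝ) : ℂ) * (star v ⬝ᵥ v) := by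
  have hcc : star c * c = ((‖c‖ ^ 2 : ℝ) : ℂ) := by
    rw [Complex.star_def, Complex.conj_mul']
    push_cast
    rfl
  rw [star_smul, smul_dotProduct, dotProduct_smul, smul_smul, hcc, smul_eq_mul]

end Graph

/-! ### The one-particle sector of the XY torus -/

section Torus

variable (d L : ℕ) [NeZero L]

/-- The torus graph `(ℤ/Lℤ)^d`, `L ≥ 3`, is `2d`-regular. [folklore] -/
theorem torus_degree_sum (hL : 3 ≤ L) (w : TorusSite d L) :
    (∑ z, if (torusGraph d L).Adj w z then (1 : ℂ) else 0) = 2 * d := by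
  rw [sum_ite_torusGraph_adj' hL]
  simp [Finset.sum_const, Finset.card_univ]
  ring

/-- **One free hard-core boson on the torus**: for `L ≥ 3`, the Perron data of the one-particle
sector `S³_tot = 1 - L^d/2` of `xyTorus d L 1` (a nonzero nonnegative sector ground vector `ψ`,
unique up to scalars) satisfy `‖Ŝ⁻_tot ψ‖² = L^d ‖ψ‖²`: `ψ` is the uniform (zero-momentum) state
`u = Σ_w δ_{1_{{w}}}`, an eigenvector by `2d`-regularity with positive overlap with `ψ`, and
`Ŝ⁻_tot u = L^d · |∅⟩`. [folklore] -/
theorem oneParticle_norm_lower (hL : 3 ≤ L) (ψ : TensorIndex (TorusSite d L) 2 → ℂ) (hψ0 : ψ ≠ 0)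
    (hψnn : ∀ σ, 0 ≤ (ψ σ).re ∧ (ψ σ).im = 0)
    (hψsec : ψ ∈ spinZSector 1 (((1 : ℕ) : ℝ) - (L : ℝ) ^ d / 2))
    (hHψ : (xyTorus d L 1) *ᵥ ψ =
      ((lowestEnergyInSector 1 (xyTorus d L 1) (((1 : ℕ) : ℝ) - (L : ℝ) ^ d / 2) : ℝ) : ℂ) • ψ)
    (huniq : ∀ ψ' : TensorIndex (TorusSite d L) 2 → ℂ,
      ψ' ∈ spinZSector 1 (((1 : ℕ) : ℝ) - (L : ℝ) ^ d / 2) →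
      (xyTorus d L 1) *ᵥ ψ' =
        ((lowestEnergyInSector 1 (xyTorus d L 1) (((1 : ℕ) : ℝ) - (L : ℝ) ^ d / 2) : ℝ) : ℂ) • ψ' →
      ∃ c : ℂ, ψ' = c • ψ) :
    (star ((totalSpin 1 0 - I • totalSpin 1 1 : Op (TorusSite d L) 2) *ᵥ ψ) ⬝ᵥ
        ((totalSpin 1 0 - I • totalSpin 1 1 : Op (TorusSite d L) 2) *ᵥ ψ)).re =
      (L : ℝ) ^ d * (star ψ ⬝ᵥ ψ).re := by
  set H : Op (TorusSite d L) 2 := xyTorus d L 1 with hHdef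
  set E : ℝ := lowestEnergyInSector 1 H (((1 : ℕ) : ℝ) - (L : ℝ) ^ d / 2) with hEdef
  set Sm : Op (TorusSite d L) 2 := totalSpin 1 0 - I • totalSpin 1 1 with hSm
  have hcard := InsertionFieldDelocalisation.Negative.card_torusSite d L
  -- the uniform one-particle state
  set u : TensorIndex (TorusSite d L) 2 → ℂ :=
    fun σ => if (Finset.univ.filter fun x => σ x = 0).card = 1 then 1 else 0 with hudef
  have hu : ∀ σ, u σ = if (Finset.univ.filter fun x => σ x = 0).card = 1 then 1 else 0 :=
    fun σ => rfl
  set φ : Finset (TorusSite d L) → ℝ := fun S => if S.card = 1 then 1 else 0 with hφdef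
  have hφu : ∀ S, φ S = (u (fun x => if x ∈ S then 0 else 1)).re := by
    intro S
    rw [hu, filter_ind_eq]
    by_cases h : S.card = 1 <;> simp [hφdef, h]
  have hureal : ∀ σ, (u σ).im = 0 := by
    intro σ
    rw [hu]
    split_ifs <;> simp
  have hsuppφ : ∀ S : Finset (TorusSite d L), S.card ≠ 1 → φ S = 0 := fun S hS => by
    rw [hφdef]
    exact if_neg hS
  -- `u` lies in the one-particle sector
  have husec : u ∈ spinZSector 1 (((1 : ℕ) : ℝ) - (L : ℝ) ^ d / 2) := by
    rw [LiebMattis.mem_spinZSector_iff]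
    intro σ hσ
    have h1 : (Finset.univ.filter fun x => σ x = 0).card = 1 := by
      by_contra h
      exact hσ (by rw [hu, if_neg h])
    conv_lhs => rw [← ind_filter_eq σ]
    rw [magnetisation_ind, h1, hcard]
    push_cast
    ring
  -- `u` is an eigenvector of `H`
  have hHu : H *ᵥ u = (((-(d : ℝ) : ℝ)) : ℂ) • u := by
    have h := xxzZero_mulVec_oneParticle (torusGraph d L) (-1) (2 * d) (torus_degree_sum d L hL) u hu
    rw [hHdef]
    convert h using 2
    push_cast
    ring
  -- `⟨u, ψ⟩ ≠ 0` : all terms are nonnegative and the charged configuration of `ψ` contributes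
  have hover : star u ⬝ᵥ ψ ≠ 0 := by
    obtain ⟨S, hS1, hSpos⟩ := exists_occSet_pos ψ 1 _ (by rw [hcard]; push_cast; ring) hψsec hψ0 hψnn
    have hterm : ∀ σ, 0 ≤ (star (u σ) * ψ σ).re := by
      intro σ
      rw [hu]
      split_ifs
      · simp [(hψnn σ).1]
      · simp
    have hpos : 0 < (star (u (fun x => if x ∈ S then 0 else 1)) *
        ψ (fun x => if x ∈ S then 0 else 1)).re := by
      rw [hu, filter_ind_eq, if_pos hS1]
      simpa using hSpos
    intro h0
    have hre := congrArg Complex.re h0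
    rw [dotProduct, Complex.re_sum, Complex.zero_re] at hre
    have : 0 < ∑ σ, (star (u σ) * ψ σ).re :=
      Finset.sum_pos' (fun σ _ => hterm σ) ⟨_, Finset.mem_univ _, hpos⟩
    simp only [Pi.star_apply] at hre
    linarith
  -- hence `u` is a sector ground vector and `u = c • ψ`
  have hEu : (((-(d : ℝ) : ℝ)) : ℂ) = (E : ℂ) :=
    eigenvalue_eq_of_dotProduct_ne_zero (xxzZero_isHermitian _ _) hHu hHψ hover
  rw [hEu] at hHu
  obtain ⟨c, hc⟩ := huniq u husec hHu
  have hu0 : u ≠ 0 := by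
    intro h
    have h1 := congrFun h (fun x => if x ∈ ({(0 : TorusSite d L)} : Finset (TorusSite d L)) then 0 else 1)
    rw [hu, filter_ind_eq, Finset.card_singleton, if_pos rfl] at h1
    exact one_ne_zero h1
  have hc0 : c ≠ 0 := by
    rintro rfl
    exact hu0 (by rw [hc, zero_smul])
  -- norms of `u` : `‖Ŝ⁻u‖² = (L^d)²`, `‖u‖² = L^d`
  have hnormu : (star u ⬝ᵥ u).re = (L : ℝ) ^ d := by
    rw [re_norm_eq_sum_sq u hureal φ hφu]
    have h1 : ∀ S : Finset (TorusSite d L), φ S ^ 2 = if S.card = 1 then 1 else 0 := by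
      intro S
      by_cases h : S.card = 1 <;> simp [hφdef, h]
    simp_rw [h1]
    rw [Finset.sum_boole]
    have hpc : (Finset.univ.filter fun S : Finset (TorusSite d L) => S.card = 1) =
        Finset.univ.powersetCard 1 := by
      ext S
      simp [Finset.mem_powersetCard]
    rw [hpc, Finset.card_powersetCard, Finset.card_univ, hcard, Nat.choose_one_right]
    push_cast
    ring
  have hloweru : (star (Sm *ᵥ u) ⬝ᵥ (Sm *ᵥ u)).re = ((L : ℝ) ^ d) ^ 2 := by
    rw [hSm, re_norm_lower_eq_pairSum 1 u hureal φ hφu hsuppφ]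
    have hdiag : ∀ x : TorusSite d L,
        (∑ S : Finset (TorusSite d L), (if x ∈ S then φ S ^ 2 else 0)) = 1 := by
      intro x
      rw [Finset.sum_eq_single {x}]
      · simp [hφdef]
      · intro S _ hS
        by_cases hx : x ∈ S
        · rw [if_pos hx, hφdef]
          simp only
          rw [if_neg, zero_pow two_ne_zero]
          intro h1
          obtain ⟨a, rfl⟩ := Finset.card_eq_one.mp h1
          rw [Finset.mem_singleton] at hx
          subst hx
          exact hS rfl
        · rw [if_neg hx]
      · intro h
        exact absurd (Finset.mem_univ _) h
    have hoff : ∀ x y : TorusSite d L,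
        (∑ T ∈ (Finset.univ : Finset (TorusSite d L)).powersetCard (1 - 1),
          (if x ∉ T ∧ y ∉ T then φ (insert x T) * φ (insert y T) else 0)) = 1 := by
      intro x y
      rw [Nat.sub_self, Finset.powersetCard_zero, Finset.sum_singleton,
        if_pos ⟨Finset.notMem_empty x, Finset.notMem_empty y⟩]
      simp [hφdef]
    simp_rw [hdiag, hoff, ite_self, Finset.sum_const, Finset.card_univ, hcard, nsmul_eq_mul, mul_one]
    push_cast
    ring
  -- transfer to `ψ = c⁻¹ u`
  have h1 : (star (Sm *ᵥ u) ⬝ᵥ (Sm *ᵥ u)).re = ‖c‖ ^ 2 * (star (Sm *ᵥ ψ) ⬝ᵥ (Sm *ᵥ ψ)).re := by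
    rw [hc, mulVec_smul, star_smul_dotProduct_smul, Complex.re_ofReal_mul]
  have h2 : (star u ⬝ᵥ u).re = ‖c‖ ^ 2 * (star ψ ⬝ᵥ ψ).re := by
    rw [hc, star_smul_dotProduct_smul, Complex.re_ofReal_mul]
  rw [h1] at hloweru
  rw [h2] at hnormu
  have hcn : (0 : ℝ) < ‖c‖ ^ 2 := pow_pos (norm_pos_iff.mpr hc0) 2
  have key : ‖c‖ ^ 2 * (star (Sm *ᵥ ψ) ⬝ᵥ (Sm *ᵥ ψ)).re =
      ‖c‖ ^ 2 * ((L : ℝ) ^ d * (star ψ ⬝ᵥ ψ).re) := by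
    rw [hloweru, ← mul_assoc, mul_comm (‖c‖ ^ 2) ((L : ℝ) ^ d), mul_assoc, hnormu, sq]
  exact mul_left_cancel₀ hcn.ne' key

end Torus

end Summit.AtomisticToContinuum.BoseEinsteinCondensation.Theorems.LatticeCoherence
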